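import Summits.QuantumFields.QCD.Theorems.SeaNonGibbsUniformLoopPotentialDirac
import Literature.MathematicalPhysics.QuantumFieldTheory.QCDPhaseQuenched
import Mathlib.MeasureTheory.Function.LocallyIntegrable
import HarnessLib

/-!
# Single-link conditional laws: locality of the gauge factor and the total-variation lemma

Route `SeaNonGibbs` (QCD), item `UniformLoopPotential` (stmt-QuantumFields-8858), the two
ingredients besides the fermion determinant:

* `wilsonAction_update_sub_eq` — the Wilson action of `U[e₀ ↦ u]` depends on `u` only through the
  plaquettes containing `e₀`, whose links are based within `ℓ¹` distance `2` of `x₀ = e₀.1`; hence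
  for two fields agreeing there (except on `e₀`) the difference
  `S(U[e₀↦u]) − S(U'[e₀↦u])` does not depend on `u`;
* `integral_abs_sub_div_le` — the abstract total-variation estimate: if
  `a c g ≤ f ≤ b c g` pointwise with `g > 0` integrable and `0 < a ≤ b`, then the normalised
  densities satisfy `∫ |f/∫f − g/∫g| ≤ b/a − 1`;
* `div_pow_sub_one_le` — `((1+δ)/(1−δ))^K − 1 ≤ 2^(K+2) δ` for `0 ≤ δ ≤ 1/4` (chord bound);
* continuity of the single-link weight `u ↦ e^{−β S(U[e₀↦u])} |det D_W(U[e₀↦u])|^{N_f}`.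

Seat ym-line-fcl-p3 g19, free hands; nothing here is specific to confinement or the mass gap.
-/

noncomputable section

open Matrix Finset MeasureTheory
open Literature.Probability.LatticeModels (TorusSite)
open Literature.MathematicalPhysics.QuantumFieldTheory
open Literature.MathematicalPhysics.QuantumLattice

namespace Summit.QuantumFields.QCD.Theorems

namespace UniformLoopPotential

/-! ## Locality of the Wilson action under a single-link update -/

section Action

variable {L N : ℕ} [NeZero L] {G : Type*} [Group G] (ρ : G →* Matrix (Fin N) (Fin N) ℂ)

omit [NeZero L] in
/-- A plaquette not containing `e₀` does not see the update at `e₀`. -/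
theorem plaquetteHolonomy_update_of_not_mem (V : GaugeConfig 4 L G) (e₀ : Edge 4 L) (w : G)
    {x : TorusSite 4 L} {i j : Fin 4}
    (h : ¬ ((x, i) = e₀ ∨ (Site.shift x i, j) = e₀ ∨ (Site.shift x j, i) = e₀ ∨ (x, j) = e₀)) :
    plaquetteHolonomy (Function.update V e₀ w) x i j = plaquetteHolonomy V x i j := by
  push Not at h
  obtain ⟨h1, h2, h3, h4⟩ := h
  simp only [plaquetteHolonomy, Function.update_of_ne h1, Function.update_of_ne h2,
    Function.update_of_ne h3, Function.update_of_ne h4]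

omit [NeZero L] in
/-- Plaquette holonomies only read their four links. -/
theorem plaquetteHolonomy_congr {V W : GaugeConfig 4 L G} {x : TorusSite 4 L} {i j : Fin 4}
    (h1 : V (x, i) = W (x, i)) (h2 : V (Site.shift x i, j) = W (Site.shift x i, j))
    (h3 : V (Site.shift x j, i) = W (Site.shift x j, i)) (h4 : V (x, j) = W (x, j)) :
    plaquetteHolonomy V x i j = plaquetteHolonomy W x i j := by
  simp only [plaquetteHolonomy, h1, h2, h3, h4]

/-- The three base sites of a plaquette are pairwise within `ℓ¹` distance `2`. -/
theorem siteDist_plaquette_le_two (x : TorusSite 4 L) (i j : Fin 4) {a b : TorusSite 4 L}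
    (ha : a = x ∨ a = Site.shift x i ∨ a = Site.shift x j)
    (hb : b = x ∨ b = Site.shift x i ∨ b = Site.shift x j) :
    (∑ k, (a k - b k).valMinAbs.natAbs) ≤ 2 := by
  have t1 := siteDist_shift_le x i
  have t2 := siteDist_shift_le x j
  have t1' := siteDist_shift_le' x i
  have t2' := siteDist_shift_le' x j
  have tij := (siteDist_triangle (Site.shift x i) x (Site.shift x j)).trans (add_le_add t1' t2)
  have tji := (siteDist_triangle (Site.shift x j) x (Site.shift x i)).trans (add_le_add t2' t1)
  rcases ha with rfl | rfl | rfl <;> rcases hb with rfl | rfl | rfl <;>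
    first | (rw [siteDist_self]; omega) | omega

/-- **Locality of the gauge factor.** If `U, U'` agree on every link `e ≠ e₀` based within distance
`Λ ≥ 2` of `x₀`, then `S(U[e₀↦u]) − S(U'[e₀↦u])` does not depend on `u`. -/
theorem wilsonAction_update_sub_eq {U U' : GaugeConfig 4 L G} {e₀ : Edge 4 L} {Λ : ℕ} (hΛ : 2 ≤ Λ)
    (hUU' : ∀ e : Edge 4 L, (∑ i, (e.1 i - e₀.1 i).valMinAbs.natAbs) ≤ Λ → e ≠ e₀ → U e = U' e)
    (u v : G) :
    wilsonAction ρ (Function.update U e₀ u) - wilsonAction ρ (Function.update U' e₀ u) =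
      wilsonAction ρ (Function.update U e₀ v) - wilsonAction ρ (Function.update U' e₀ v) := by
  unfold wilsonAction
  rw [← Finset.sum_sub_distrib, ← Finset.sum_sub_distrib]
  refine Finset.sum_congr rfl fun pl _ => ?_
  obtain ⟨x, ⟨⟨i, j⟩, hij⟩⟩ := pl
  dsimp only
  by_cases hmem : (x, i) = e₀ ∨ (Site.shift x i, j) = e₀ ∨ (Site.shift x j, i) = e₀ ∨ (x, j) = e₀
  · -- `e₀` is a link of the plaquette: the two fields agree on all four links after the update
    have hx₀ : e₀.1 = x ∨ e₀.1 = Site.shift x i ∨ e₀.1 = Site.shift x j := by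
      rcases hmem with h | h | h | h <;> rw [← h] <;> simp
    have hlink : ∀ (w : G) (ℓ : Edge 4 L), (ℓ.1 = x ∨ ℓ.1 = Site.shift x i ∨ ℓ.1 = Site.shift x j) →
        Function.update U e₀ w ℓ = Function.update U' e₀ w ℓ := by
      intro w ℓ hℓ
      by_cases he : ℓ = e₀
      · rw [he, Function.update_self, Function.update_self]
      · rw [Function.update_of_ne he, Function.update_of_ne he]
        exact hUU' ℓ ((siteDist_plaquette_le_two x i j hℓ hx₀).trans hΛ) he
    have hhol : ∀ w : G, plaquetteHolonomy (Function.update U e₀ w) x i j =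
        plaquetteHolonomy (Function.update U' e₀ w) x i j := fun w =>
      plaquetteHolonomy_congr (hlink w (x, i) (Or.inl rfl)) (hlink w (Site.shift x i, j) (Or.inr (Or.inl rfl)))
        (hlink w (Site.shift x j, i) (Or.inr (Or.inr rfl))) (hlink w (x, j) (Or.inl rfl))
    rw [hhol u, hhol v, sub_self, sub_self]
  · rw [plaquetteHolonomy_update_of_not_mem U e₀ u hmem, plaquetteHolonomy_update_of_not_mem U' e₀ u hmem,
      plaquetteHolonomy_update_of_not_mem U e₀ v hmem, plaquetteHolonomy_update_of_not_mem U' e₀ v hmem]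

variable [TopologicalSpace G] [IsTopologicalGroup G]

/-- The Wilson action is continuous in the gauge field (continuous `ρ`). -/
theorem continuous_wilsonAction' (hρ : Continuous ρ) :
    Continuous fun V : GaugeConfig 4 L G => wilsonAction ρ V := by
  unfold wilsonAction
  refine continuous_finsetSum _ fun p _ => ?_
  have h1 : Continuous fun U : GaugeConfig 4 L G => plaquetteHolonomy U p.1 p.2.1.1 p.2.1.2 := by
    unfold plaquetteHolonomy; fun_prop
  exact continuous_const.sub (Complex.continuous_re.comp (hρ.comp h1).matrix_trace)

/-- **The single-link weight is continuous in the link variable**: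
`u ↦ exp(−β S(U[e₀↦u])) · |det D_W(U[e₀↦u], m, 1)|^{N_f}`. -/
theorem continuous_linkWeight (hρ : Continuous ρ) (β m : ℝ) (Nf : ℕ) (U : GaugeConfig 4 L G)
    (e₀ : Edge 4 L) :
    Continuous fun u : G => Real.exp (-β * wilsonAction ρ (Function.update U e₀ u)) *
      ‖(wilsonDirac ρ (Function.update U e₀ u) m 1).det‖ ^ Nf := by
  have hupd : Continuous fun u : G => Function.update U e₀ u := continuous_const.update e₀ continuous_id
  refine ((continuous_const.mul ((continuous_wilsonAction' ρ hρ).comp hupd)).rexp).mul ?_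
  exact (((continuous_wilsonDirac ρ hρ m 1).comp hupd).matrix_det.norm).pow Nf

end Action

/-! ## The abstract total-variation lemma -/

section TV

variable {X : Type*} [MeasurableSpace X] (μ : Measure X)

/-- Pointwise step: from `a c g ≤ f ≤ b c g` and `a c Zg ≤ Zf ≤ b c Zg` (all positive),
`|f/Zf − g/Zg| ≤ (b/a − 1) (g/Zg)`. -/
theorem abs_div_sub_div_le {f g c a b Zf Zg : ℝ} (hg : 0 < g) (hc : 0 < c) (ha : 0 < a)
    (hab : a ≤ b) (hZg : 0 < Zg) (hfl : a * c * g ≤ f) (hfu : f ≤ b * c * g)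
    (hZl : a * c * Zg ≤ Zf) (hZu : Zf ≤ b * c * Zg) :
    |f / Zf - g / Zg| ≤ (b / a - 1) * (g / Zg) := by
  have hb : 0 < b := lt_of_lt_of_le ha hab
  have hZf : 0 < Zf := lt_of_lt_of_le (by positivity) hZl
  -- upper bound `f/Zf ≤ (b/a) g/Zg`
  have hup : f / Zf ≤ (b / a) * (g / Zg) := by
    rw [div_le_iff₀ hZf]
    calc f ≤ b * c * g := hfu
      _ = (b / a) * (g / Zg) * (a * c * Zg) := by field_simp
      _ ≤ (b / a) * (g / Zg) * Zf := by gcongr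
  -- lower bound `(a/b) g/Zg ≤ f/Zf`
  have hlow : (a / b) * (g / Zg) ≤ f / Zf := by
    rw [le_div_iff₀ hZf]
    calc (a / b) * (g / Zg) * Zf ≤ (a / b) * (g / Zg) * (b * c * Zg) := by gcongr
      _ = a * c * g := by field_simp
      _ ≤ f := hfl
  have hgZ : 0 ≤ g / Zg := by positivity
  have hsym : 1 - a / b ≤ b / a - 1 := by
    rw [show 1 - a / b = (b - a) / b by field_simp, show b / a - 1 = (b - a) / a by field_simp]
    exact div_le_div_of_nonneg_left (sub_nonneg.2 hab) ha hab
  rw [abs_sub_le_iff]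
  constructor
  · calc f / Zf - g / Zg ≤ (b / a) * (g / Zg) - g / Zg := by linarith
      _ = (b / a - 1) * (g / Zg) := by ring
  · calc g / Zg - f / Zf ≤ g / Zg - (a / b) * (g / Zg) := by linarith
      _ = (1 - a / b) * (g / Zg) := by ring
      _ ≤ (b / a - 1) * (g / Zg) := mul_le_mul_of_nonneg_right hsym hgZ

/-- **Total-variation lemma.** If `a c g ≤ f ≤ b c g` pointwise, `g > 0` integrable with
`∫ g > 0`, `f` integrable, `0 < a ≤ b`, `0 < c`, then `∫ |f/∫f − g/∫g| ≤ b/a − 1`. -/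
theorem integral_abs_sub_div_le {f g : X → ℝ} (hfi : Integrable f μ) (hgi : Integrable g μ)
    (hg : ∀ x, 0 < g x) {c a b : ℝ} (hc : 0 < c) (ha : 0 < a) (hab : a ≤ b)
    (hfl : ∀ x, a * c * g x ≤ f x) (hfu : ∀ x, f x ≤ b * c * g x) (hZg : 0 < ∫ x, g x ∂μ) :
    ∫ x, |f x / (∫ y, f y ∂μ) - g x / (∫ y, g y ∂μ)| ∂μ ≤ b / a - 1 := by
  set Zf : ℝ := ∫ y, f y ∂μ with hZf
  set Zg : ℝ := ∫ y, g y ∂μ with hZgdef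
  have hZl : a * c * Zg ≤ Zf := by
    rw [hZgdef, ← integral_const_mul]
    exact integral_mono (hgi.const_mul _) hfi fun x => hfl x
  have hZu : Zf ≤ b * c * Zg := by
    rw [hZgdef, ← integral_const_mul]
    exact integral_mono hfi (hgi.const_mul _) fun x => hfu x
  have hpt : ∀ x, |f x / Zf - g x / Zg| ≤ (b / a - 1) * (g x / Zg) := fun x =>
    abs_div_sub_div_le (hg x) hc ha hab hZg (hfl x) (hfu x) hZl hZu
  calc ∫ x, |f x / Zf - g x / Zg| ∂μ ≤ ∫ x, (b / a - 1) * (g x / Zg) ∂μ :=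
        integral_mono ((hfi.div_const Zf).sub (hgi.div_const Zg)).abs
          ((hgi.div_const Zg).const_mul _) hpt
    _ = (b / a - 1) * ((∫ x, g x ∂μ) / Zg) := by
        rw [integral_const_mul, integral_div]
    _ = b / a - 1 := by
        rw [← hZgdef, div_self hZg.ne', mul_one]

/-- **Trivial total-variation bound**: two probability densities are at `L¹` distance `≤ 2`. -/
theorem integral_abs_sub_div_le_two {f g : X → ℝ} (hfi : Integrable f μ) (hgi : Integrable g μ)
    (hf : ∀ x, 0 ≤ f x) (hg : ∀ x, 0 ≤ g x) (hZf : 0 < ∫ x, f x ∂μ) (hZg : 0 < ∫ x, g x ∂μ) :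
    ∫ x, |f x / (∫ y, f y ∂μ) - g x / (∫ y, g y ∂μ)| ∂μ ≤ 2 := by
  set Zf : ℝ := ∫ y, f y ∂μ with hZfdef
  set Zg : ℝ := ∫ y, g y ∂μ with hZgdef
  have hpt : ∀ x, |f x / Zf - g x / Zg| ≤ f x / Zf + g x / Zg := fun x => by
    have h1 : 0 ≤ f x / Zf := div_nonneg (hf x) hZf.le
    have h2 : 0 ≤ g x / Zg := div_nonneg (hg x) hZg.le
    rw [abs_sub_le_iff]; constructor <;> linarith
  calc ∫ x, |f x / Zf - g x / Zg| ∂μ ≤ ∫ x, (f x / Zf + g x / Zg) ∂μ :=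
        integral_mono ((hfi.div_const Zf).sub (hgi.div_const Zg)).abs
          ((hfi.div_const Zf).add (hgi.div_const Zg)) hpt
    _ = Zf / Zf + Zg / Zg := by
        rw [integral_add (hfi.div_const Zf) (hgi.div_const Zg), integral_div, integral_div]
    _ = 2 := by rw [div_self hZf.ne', div_self hZg.ne']; norm_num

/-- **`((1+δ)/(1−δ))^K − 1 ≤ 2^(K+2) δ` for `0 ≤ δ ≤ 1/4`.** -/
theorem div_pow_sub_one_le {δ : ℝ} (hδ0 : 0 ≤ δ) (hδ : δ ≤ 1 / 4) (K : ℕ) :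
    ((1 + δ) / (1 - δ)) ^ K - 1 ≤ 2 ^ (K + 2) * δ := by
  have h1 : (1 + δ) / (1 - δ) ≤ 1 + 4 * δ := by
    rw [div_le_iff₀ (by linarith)]
    nlinarith
  have h0 : 0 ≤ (1 + δ) / (1 - δ) := div_nonneg (by linarith) (by linarith)
  calc ((1 + δ) / (1 - δ)) ^ K - 1 ≤ (1 + 4 * δ) ^ K - 1 := by gcongr
    _ ≤ (2 ^ K - 1) * (4 * δ) := by
        -- chord bound for the convex power `(1 + y)^K ≤ 1 + (2^K − 1) y` on `[0, 1]`
        -- (the tree's `KineticTheory.one_add_pow_le_one_add_mul`, re-derived to keep the import cone small)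
        have chord : ∀ {y : ℝ}, 0 ≤ y → y ≤ 1 → ∀ n : ℕ, (1 + y) ^ n ≤ 1 + (2 ^ n - 1) * y := by
          intro y hy0 hy1 n
          induction n with
          | zero => simp
          | succ n ih =>
            have h2n : (1 : ℝ) ≤ 2 ^ n := one_le_pow₀ (by norm_num)
            have hyy : y * y ≤ y := by nlinarith
            calc (1 + y) ^ (n + 1) = (1 + y) * (1 + y) ^ n := by ring
              _ ≤ (1 + y) * (1 + (2 ^ n - 1) * y) := by gcongr
              _ = 1 + (2 ^ n - 1) * y + y + (2 ^ n - 1) * (y * y) := by ring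
              _ ≤ 1 + (2 ^ n - 1) * y + y + (2 ^ n - 1) * y := by
                  nlinarith [mul_le_mul_of_nonneg_left hyy (by linarith : (0 : ℝ) ≤ 2 ^ n - 1)]
              _ = 1 + (2 ^ (n + 1) - 1) * y := by ring
        have := chord (y := 4 * δ) (by linarith) (by linarith) K
        linarith
    _ ≤ 2 ^ K * (4 * δ) := by gcongr; linarith
    _ = 2 ^ (K + 2) * δ := by ring

end TV

end UniformLoopPotential

end Summit.QuantumFields.QCD.Theorems

end
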